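import Summits.CriticalPhenomena.PercolationContinuityZ3.Theorems.PercNearOneGluingNoHeavyLowerTailSunflowerPrincipalCore
import Literature.Probability.LatticeModels.ProdBernoulliCoupling
import Summits.CriticalPhenomena.PercolationContinuityZ3.Theorems.PercNearOneGluingNoHeavyLowerTailCovKLInduction
import HarnessLib

/-!
# `NoHeavyLowerTail` (crux stmt-CriticalPhenomena-4575), abstract sunflower cubic at LAW level: the MARKED-POINT STEP —
# `H(F, p) ≥ (1 − p_e)² · H(F ∖ e, p)` whenever the singleton `{e}` lies in one of the three up-sets

Support file (seat `prim-ineq-gen-2` gen 28; `--supports stmt-CriticalPhenomena-4575`; companion of prove-1's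
`…SunflowerPrincipalCore` (`lawH_nonneg` on the principal-core stratum)).  Nothing is asserted about the crux; no `sorry`,
no named facts, standard axioms.  Memo: run/shared/lean/prim/prim-ineq-gen-2/LAW-INDUCTION-GEN28.md §3.

SETTING.  `μ = prodBernoulli p` on `Set ι`, `ι` finite.  A three-petal SUNFLOWER of up-sets: increasing events `E₁, E₂, E₃` with
`E₁ ∩ E₂ = E₁ ∩ E₃ = E₂ ∩ E₃ = A`; cells `a = μ A`, `c_i = μ (E_i ∖ A)`, `b = μ (E₁ ∪ E₂ ∪ E₃)ᶜ`.  The lane's law-level conjecture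
H-COMB (INEQ-CLAIMS l.1060; the law-level shadow of `PartitionLemmaH`) is `H := (a + b)(ab − e₂(c)) − e₃(c) ≥ 0` for every
such sunflower and every `p`; `sixH` below is `6·H` as an explicit cubic in the five cells.

ONE-COORDINATE (BERNSTEIN) DECOMPOSITION (memo §2).  Fix a coordinate `e` and put `t = p e`, `μ₀ = prodBernoulli (p[e ↦ 0])`
(the law of `F ∖ e`), `μ₁ = prodBernoulli (p[e ↦ 1])` (the law of `F / e`).  Every cell is affine in `t`:
`μ X = (1 − t) μ₀ X + t μ₁ X` (`prodBernoulli_real_oneBond`, events determined by the full window, `CovKL.determinedBy_coe_univ`), so `6H(F, p)` is a cubic in `t` whose Bernstein coefficients are the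
mixed trilinear values `T(m₁, m₀, m₀)`, `T(m₁, m₁, m₀)` of the symmetric trilinear form of `6H` at the two cell vectors.

THE MARKED-POINT CASE (this file).  If `{e} ∈ E₁` ("`e` carries a mark of colour 1"; the case `{e} ∈ A` is included), then under
`μ₁` every configuration contains `e`, hence lies in `E₁`, and lies in `E₂` or `E₃` only if it lies in `A`: the `μ₁`-cells are
`b' = c₂' = c₃' = 0`, `c₁' = 1 − a'`, and `a' = μ₁ A ≥ μ₀ (E₂ ∪ E₃) = a + c₂ + c₃` (monotonicity in `p`).  With `s := a' − a − c₂ − c₃ ≥ 0`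
and `AG := ab − e₂(c) ≥ 0` (Gladkov's strong Harris inequality for `F ∖ e`, `prodBernoulli_strongHarris_sunflower_three`) one has
the EXACT IDENTITY (memo §3; found by an exact rational LP, checked symbolically)
  `6H(F,p) − (1−t)²·6H(F∖e) = 3t(1−t)²·P₁ + 3t²(1−t)·P₂`,
  `P₁ = 2a'·AG + 2(b²s + b c₂ s + b c₃ s + b a s + c₂c₃a + c₂c₃s + c₂ a s + c₃ a s)`,
  `P₂ = 2a'·AG + 2(b c₂ s + b c₃ s + b a s + b s² + c₂²c₃ + c₂²s + c₂c₃² + c₂c₃a + 3c₂c₃s + c₂ a s + c₂ s² + c₃² s + c₃ a s + c₃ s²)`,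
all of whose terms are nonnegative.  Hence:

* `LawMarkedPoint.kernel` — the algebraic step (real numbers only).
* `LawMarkedPoint.sixH_ge_of_singleton_mem` — **`(1 − p e)² · 6H(F ∖ e) ≤ 6H(F)`** for every finite product measure and every
  three-petal sunflower of up-sets with `{e} ∈ E₁`; in particular `H(F ∖ e) ≥ 0 → H(F) ≥ 0` (`sixH_nonneg_of_singleton_mem`):
  the law-level counterpart of prim-l12-p2's partition-level Theorem A (`ZP_le_ZP_insert_of_lab_singleton_ne_zero`), and the first
  proved instance of the law-level one-coordinate induction for H-COMB (H-COMB reduces to MARK-FREE sunflowers, i.e. those in which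
  no singleton lies in `E₁ ∪ E₂ ∪ E₃`).  By the symmetry of the statement in `E₁, E₂, E₃` the hypothesis `{e} ∈ E₁` covers all marks.
-/

noncomputable section

namespace Summit.CriticalPhenomena.PercolationContinuityZ3.Theorems.SunflowerPartition

namespace LawMarkedPoint

open MeasureTheory
open Literature.Probability.LatticeModels Literature.Probability.Percolation

variable {ι : Type*}

/-! ## The cubic `6H` and the algebraic kernel -/

/-- `6·H = 6[(a + b)(ab − (c₁c₂ + c₁c₃ + c₂c₃)) − c₁c₂c₃]`, the abstract sunflower cubic as a function of the five cell masses
(bottom `b`, petals `c₁ c₂ c₃`, top `a`). [this work] -/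
def sixH (b c₁ c₂ c₃ a : ℝ) : ℝ :=
  6 * ((a + b) * (a * b - (c₁ * c₂ + c₁ * c₃ + c₂ * c₃)) - c₁ * c₂ * c₃)

/-- **Algebraic kernel of the marked-point step.**  For nonnegative cells `(b, c₁, c₂, c₃, a)` satisfying Gladkov's inequality
`c₁c₂ + c₁c₃ + c₂c₃ ≤ ab`, a top mass `a' ≥ a + c₂ + c₃` of the contracted structure (whose other cells are `b' = c₂' = c₃' = 0`,
`c₁' = σ − a'`, `σ = a + b + c₁ + c₂ + c₃`) and `t ∈ [0, 1]`, the cubic of the mixed cells `(1−t)·m₀ + t·m₁` is at least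
`(1−t)²` times the cubic of `m₀`.  Proof: the exact Bernstein identity of the file docstring. [this work] -/
theorem kernel (b c₁ c₂ c₃ a a' t : ℝ) (hb : 0 ≤ b) (hc₂ : 0 ≤ c₂) (hc₃ : 0 ≤ c₃) (ha : 0 ≤ a)
    (ht0 : 0 ≤ t) (ht1 : t ≤ 1) (hAG : c₁ * c₂ + c₁ * c₃ + c₂ * c₃ ≤ a * b) (hlo : a + c₂ + c₃ ≤ a') :
    (1 - t) ^ 2 * sixH b c₁ c₂ c₃ a ≤
      sixH ((1 - t) * b) ((1 - t) * c₁ + t * (a + b + c₁ + c₂ + c₃ - a')) ((1 - t) * c₂) ((1 - t) * c₃)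
        ((1 - t) * a + t * a') := by
  obtain ⟨s, hs, rfl⟩ : ∃ s : ℝ, 0 ≤ s ∧ a' = a + c₂ + c₃ + s := ⟨a' - a - c₂ - c₃, by linarith, by ring⟩
  have hG : 0 ≤ a * b - (c₁ * c₂ + c₁ * c₃ + c₂ * c₃) := by linarith
  have ha' : 0 ≤ a + c₂ + c₃ + s := by linarith
  have ht' : 0 ≤ 1 - t := by linarith
  -- the two mixed Bernstein coefficients (minus (1/3)·6H₀ for the first), in certified nonnegative form
  set P₁ : ℝ := 2 * (a + c₂ + c₃ + s) * (a * b - (c₁ * c₂ + c₁ * c₃ + c₂ * c₃)) +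
      2 * (b * b * s + b * c₂ * s + b * c₃ * s + b * a * s + c₂ * c₃ * a + c₂ * c₃ * s + c₂ * a * s + c₃ * a * s)
    with hP₁_def
  set P₂ : ℝ := 2 * (a + c₂ + c₃ + s) * (a * b - (c₁ * c₂ + c₁ * c₃ + c₂ * c₃)) +
      2 * (b * c₂ * s + b * c₃ * s + b * a * s + b * s * s + c₂ * c₂ * c₃ + c₂ * c₂ * s + c₂ * c₃ * c₃ +
        c₂ * c₃ * a + 3 * (c₂ * c₃ * s) + c₂ * a * s + c₂ * s * s + c₃ * c₃ * s + c₃ * a * s + c₃ * s * s)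
    with hP₂_def
  have hP₁ : 0 ≤ P₁ := by
    rw [hP₁_def]
    have h1 := mul_nonneg (mul_nonneg (by norm_num : (0:ℝ) ≤ 2) ha') hG
    have : 0 ≤ b * b * s + b * c₂ * s + b * c₃ * s + b * a * s + c₂ * c₃ * a + c₂ * c₃ * s + c₂ * a * s + c₃ * a * s := by
      positivity
    linarith
  have hP₂ : 0 ≤ P₂ := by
    rw [hP₂_def]
    have h1 := mul_nonneg (mul_nonneg (by norm_num : (0:ℝ) ≤ 2) ha') hG
    have : 0 ≤ b * c₂ * s + b * c₃ * s + b * a * s + b * s * s + c₂ * c₂ * c₃ + c₂ * c₂ * s + c₂ * c₃ * c₃ +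
        c₂ * c₃ * a + 3 * (c₂ * c₃ * s) + c₂ * a * s + c₂ * s * s + c₃ * c₃ * s + c₃ * a * s + c₃ * s * s := by
      positivity
    linarith
  have key : sixH ((1 - t) * b) ((1 - t) * c₁ + t * (a + b + c₁ + c₂ + c₃ - (a + c₂ + c₃ + s))) ((1 - t) * c₂)
        ((1 - t) * c₃) ((1 - t) * a + t * (a + c₂ + c₃ + s)) - (1 - t) ^ 2 * sixH b c₁ c₂ c₃ a =
      3 * t * (1 - t) ^ 2 * P₁ + 3 * t ^ 2 * (1 - t) * P₂ := by
    rw [hP₁_def, hP₂_def]; unfold sixH; ring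
  have h3 : 0 ≤ 3 * t * (1 - t) ^ 2 * P₁ := by positivity
  have h4 : 0 ≤ 3 * t ^ 2 * (1 - t) * P₂ := by
    have := mul_nonneg (mul_nonneg (sq_nonneg t) ht') hP₂
    linarith
  linarith

/-! ## The law-level statement -/

/-- `6H` of the three-petal sunflower `(E₁, E₂, E₃; A)` under `prodBernoulli q`, as a function of its five cells. [this work] -/
def lawSixH (q : ι → unitInterval) (E₁ E₂ E₃ A : Set (Set ι)) : ℝ :=
  sixH ((prodBernoulli q).real (E₁ ∪ E₂ ∪ E₃)ᶜ) ((prodBernoulli q).real (E₁ \ A)) ((prodBernoulli q).real (E₂ \ A))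
    ((prodBernoulli q).real (E₃ \ A)) ((prodBernoulli q).real A)

variable [Fintype ι] [DecidableEq ι]

/-- One-bond decomposition of a cell: `μ_p X = (1 − p e)·μ_{p[e↦0]} X + (p e)·μ_{p[e↦1]} X`. [folklore] -/
theorem real_oneBond (p : ι → unitInterval) (e : ι) (X : Set (Set ι)) :
    (prodBernoulli p).real X =
      (1 - (p e : ℝ)) * (prodBernoulli (Function.update p e 0)).real X +
        (p e : ℝ) * (prodBernoulli (Function.update p e 1)).real X :=
  prodBernoulli_real_oneBond (CovKL.determinedBy_coe_univ X) p (Finset.mem_univ e)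

omit [Fintype ι] in
/-- Under `p[e ↦ 1]` the coordinate `e` is present almost surely: an event avoiding every configuration containing `e`
has probability `0`. [folklore] -/
theorem real_update_one_eq_zero (p : ι → unitInterval) (e : ι) {X : Set (Set ι)} (hX : ∀ ω ∈ X, e ∉ ω) :
    (prodBernoulli (Function.update p e 1)).real X = 0 := by
  have hsub : X ⊆ {ω : Set ι | e ∉ ω} := fun ω hω => hX ω hω
  have h0 : (prodBernoulli (Function.update p e 1)).real {ω : Set ι | e ∉ ω} = 0 := by
    rw [prodBernoulli_real_setOf_notMem]; simp
  refine le_antisymm ?_ measureReal_nonneg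
  calc (prodBernoulli (Function.update p e 1)).real X
      ≤ (prodBernoulli (Function.update p e 1)).real {ω : Set ι | e ∉ ω} := measureReal_mono hsub
    _ = 0 := h0

/-- **THE MARKED-POINT STEP (law level).**  For a finite product measure and a three-petal sunflower of up-sets
`E₁ ∩ E₂ = E₁ ∩ E₃ = E₂ ∩ E₃ = A` with a marked coordinate `{e} ∈ E₁`:
`(1 − p e)² · 6H(F ∖ e) ≤ 6H(F)`, where `F ∖ e` is the same sunflower under `p[e ↦ 0]`. [this work] -/
theorem sixH_ge_of_singleton_mem (p : ι → unitInterval) {A E₁ E₂ E₃ : Set (Set ι)}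
    (h₁ : IsUpperSet E₁) (h₂ : IsUpperSet E₂) (h₃ : IsUpperSet E₃)
    (h12 : E₁ ∩ E₂ = A) (h13 : E₁ ∩ E₃ = A) (h23 : E₂ ∩ E₃ = A) (e : ι) (he : ({e} : Set ι) ∈ E₁) :
    (1 - (p e : ℝ)) ^ 2 * lawSixH (Function.update p e 0) E₁ E₂ E₃ A ≤ lawSixH p E₁ E₂ E₃ A := by
  classical
  -- notation
  set t : ℝ := (p e : ℝ) with ht_def
  set μ₀ := prodBernoulli (Function.update p e 0) with hμ₀
  set μ₁ := prodBernoulli (Function.update p e 1) with hμ₁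
  have ht0 : 0 ≤ t := (p e).2.1
  have ht1 : t ≤ 1 := (p e).2.2
  -- structural facts from the mark: under μ₁, only the cells `A` and `E₁ ∖ A` carry mass
  have hmemE₁ : ∀ ω : Set ι, e ∈ ω → ω ∈ E₁ := fun ω hω =>
    h₁ (show ({e} : Set ι) ≤ ω from Set.singleton_subset_iff.2 hω) he
  have hB1 : μ₁.real (E₁ ∪ E₂ ∪ E₃)ᶜ = 0 := by
    refine real_update_one_eq_zero p e fun ω hω heω => hω ?_
    exact Or.inl (Or.inl (hmemE₁ ω heω))
  have hC21 : μ₁.real (E₂ \ A) = 0 := by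
    refine real_update_one_eq_zero p e fun ω hω heω => hω.2 ?_
    rw [← h12]; exact ⟨hmemE₁ ω heω, hω.1⟩
  have hC31 : μ₁.real (E₃ \ A) = 0 := by
    refine real_update_one_eq_zero p e fun ω hω heω => hω.2 ?_
    rw [← h13]; exact ⟨hmemE₁ ω heω, hω.1⟩
  -- cell bookkeeping (total mass 1) at μ₀ and μ₁
  obtain ⟨-, -, -, hb0⟩ := PrincipalCore.cells_eq (Function.update p e 0) (E₁ := E₁) (E₂ := E₂) (E₃ := E₃) h12 h13 h23
  obtain ⟨-, e21, e31, hb1⟩ := PrincipalCore.cells_eq (Function.update p e 1) (E₁ := E₁) (E₂ := E₂) (E₃ := E₃) h12 h13 h23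
  -- monotonicity in `p`: μ₀ (E₂ ∪ E₃) ≤ μ₁ (E₂ ∪ E₃), i.e. a + c₂ + c₃ ≤ a'
  have hpq : Function.update p e 0 ≤ Function.update p e 1 := by
    intro i
    by_cases hi : i = e
    · subst hi; simp
    · simp [Function.update_of_ne hi]
  have m₂ : MeasurableSet E₂ := MeasurableSet.of_discrete
  have m₃ : MeasurableSet E₃ := MeasurableSet.of_discrete
  have hmono : μ₀.real (E₂ ∪ E₃) ≤ μ₁.real (E₂ ∪ E₃) :=
    prodBernoulli_real_mono_of_isUpperSet hpq (h₂.union h₃) (m₂.union m₃)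
  have hU0 : μ₀.real (E₂ ∪ E₃) = μ₀.real E₂ + μ₀.real E₃ - μ₀.real A := by
    have h := measureReal_union_add_inter (μ := μ₀) (s := E₂) m₃
    rw [h23] at h; linarith
  have hU1 : μ₁.real (E₂ ∪ E₃) = μ₁.real E₂ + μ₁.real E₃ - μ₁.real A := by
    have h := measureReal_union_add_inter (μ := μ₁) (s := E₂) m₃
    rw [h23] at h; linarith
  obtain ⟨-, e20, e30, -⟩ := PrincipalCore.cells_eq (Function.update p e 0) (E₁ := E₁) (E₂ := E₂) (E₃ := E₃) h12 h13 h23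
  have hlo : μ₀.real A + μ₀.real (E₂ \ A) + μ₀.real (E₃ \ A) ≤ μ₁.real A := by
    have := hmono; rw [hU0, hU1, e20, e30, e21, e31, hC21, hC31] at this; linarith
  -- Gladkov's strong Harris inequality for `F ∖ e`
  have hAG := prodBernoulli_strongHarris_sunflower_three (Function.update p e 0) h₁ h₂ h₃ h12 h13 h23
  -- the five one-bond decompositions
  have dB := real_oneBond p e (E₁ ∪ E₂ ∪ E₃)ᶜ
  have dA := real_oneBond p e A
  have d1 := real_oneBond p e (E₁ \ A)
  have d2 := real_oneBond p e (E₂ \ A)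
  have d3 := real_oneBond p e (E₃ \ A)
  -- the μ₁-cell of `E₁ ∖ A` is `1 − a' = σ₀ − a'`
  have hc11 : μ₁.real (E₁ \ A) =
      μ₀.real A + μ₀.real (E₁ ∪ E₂ ∪ E₃)ᶜ + μ₀.real (E₁ \ A) + μ₀.real (E₂ \ A) + μ₀.real (E₃ \ A) - μ₁.real A := by
    rw [hB1, hC21, hC31] at hb1
    linarith
  have K := kernel (μ₀.real (E₁ ∪ E₂ ∪ E₃)ᶜ) (μ₀.real (E₁ \ A)) (μ₀.real (E₂ \ A)) (μ₀.real (E₃ \ A)) (μ₀.real A)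
    (μ₁.real A) t measureReal_nonneg measureReal_nonneg measureReal_nonneg measureReal_nonneg ht0 ht1 hAG hlo
  unfold lawSixH
  rw [dB, dA, d1, d2, d3, hB1, hC21, hC31, hc11]
  convert K using 2 <;> ring

/-- **Corollary (marked-point reduction of H-COMB).**  If `{e} ∈ E₁` and the law-level cubic is nonnegative for `F ∖ e`
(i.e. under `p[e ↦ 0]`), then it is nonnegative for `F`: minimal counterexamples to H-COMB are mark-free. [this work] -/
theorem sixH_nonneg_of_singleton_mem (p : ι → unitInterval) {A E₁ E₂ E₃ : Set (Set ι)}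
    (h₁ : IsUpperSet E₁) (h₂ : IsUpperSet E₂) (h₃ : IsUpperSet E₃)
    (h12 : E₁ ∩ E₂ = A) (h13 : E₁ ∩ E₃ = A) (h23 : E₂ ∩ E₃ = A) (e : ι) (he : ({e} : Set ι) ∈ E₁)
    (h0 : 0 ≤ lawSixH (Function.update p e 0) E₁ E₂ E₃ A) : 0 ≤ lawSixH p E₁ E₂ E₃ A :=
  le_trans (mul_nonneg (sq_nonneg _) h0) (sixH_ge_of_singleton_mem p h₁ h₂ h₃ h12 h13 h23 e he)

end LawMarkedPoint

end Summit.CriticalPhenomena.PercolationContinuityZ3.Theorems.SunflowerPartition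

end
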